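import Summits.QuantumAdvantage.QuantumAdvantage.Theorems.RingFrameRingHardLogDegOfWalkHard
import Summits.QuantumAdvantage.AdviceFreeQNC0.CrossTeamRectangles
import HarnessLib

/-!
# Route RingFrame, aside `RingHardLogDeg` (stmt-QuantumAdvantage-19453): the aside follows from a
# POSITIVE DENSITY OF GOOD RECTANGLES at the balanced cut (the rectangle mechanism, assembled)

`CrossTeamRectangles.lean` (prover qn-prover-3 gen 7): every transversal 3×3 rectangle on which the two
block profiles `F0 y`, `F1 y` of a walk strategy are row- resp. column-constant contains a failure, so
`#{good rectangles} ≤ 9·4^L·4^{L'}·#FAIL` (`card_goodRectangles_le_fail`).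
`RingFrameRingHardLogDegOfWalkHard.lean`: the aside is its walk form (`ringHardLogDeg_of_walkHard`).
Composing the two:

* **`ringHardLogDeg_of_goodRectangles`** — IF there are `δ > 0` and `L₀` such that for all BALANCED
  cuts `L₀ ≤ L ≤ L' ≤ L + 1` every charge-`(L+L'+2)` walk strategy `y` on `L + L'` bits of `𝔽₂`-degree
  `≤ log₄(L+L'+1) − log₄(log₂(L+L'+1) + 1) − 3` has at least `δ·8^L·8^{L'}` good rectangles
  (`u⃗ : Fin 3 → {0,1}^L` with `|u_i| ≡ i`, `v⃗ : Fin 3 → {0,1}^{L'}` with `|v_j| ≡ j`, `F0 y (u i) (v j)`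
  independent of `j`, `F1 y (v j) (u i)` independent of `i`), THEN `RingHardLogDeg` holds
  (with `θ = 1 − δ/18`).

This is the precise shape of the open lemma `GoodRectangleDensity` of memo PROVER3-MEMO-gen7 §2, in
the kernel: the degree `log₄ n − O(log log n)` is the Viola–Wigderson regime, where joint level sets of
`O(1)` selectors are residue-equidistributed (`LevelSetResidueBalance.atom_class_ge`) — the only way
the degree is expected to enter a proof of the hypothesis (its half-cross-free case is
`CrossTeamHalfFree.lean`).  The cell's bookkeeping (prover qn-prover-3 gen 7, 2026-08-27).
WHAT THIS IS NOT: the hypothesis is OPEN; conditional reduction, credits nothing; α untouched;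
separation NOT moved.
-/

-- the sub-problem namespace `Summit.QuantumAdvantage.QuantumAdvantage` repeats the summit name by design (D-0017)
set_option linter.dupNamespace false

noncomputable section

namespace Summit.QuantumAdvantage.QuantumAdvantage.Theorems

open Finset Summit.QuantumAdvantage.AdviceFreeQNC0
open Literature.Computability.QuantumComplexity Literature.Computability.QuantumComplexity.RingHLF
open Literature.Computability.MetaComplexity Literature.Computability.MetaComplexity.Smolensky

/-- **`RingHardLogDeg` from a positive density of good rectangles at the balanced cut.**
If for some `δ > 0` and all balanced cuts `L₀ ≤ L ≤ L' ≤ L + 1` every charge-`(L + L' + 2)` walk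
strategy on `L + L'` bits of degree `≤ log₄(L+L'+1) − log₄(log₂(L+L'+1) + 1) − 3` has at least
`δ·8^L·8^{L'}` good transversal rectangles, then the aside `RingHardLogDeg` holds. -/
theorem ringHardLogDeg_of_goodRectangles
    (hG : ∃ δ : ℝ, 0 < δ ∧ ∃ L₀ : ℕ, ∀ L L' : ℕ, L₀ ≤ L → L ≤ L' → L' ≤ L + 1 →
      ∀ y : Fin (L + L' + 1) → (Fin (L + L') → Bool) → Bool,
        (∀ g, HasDeg (y g)
          (Nat.log 4 (L + L' + 1) - Nat.log 4 (Nat.log 2 (L + L' + 1) + 1) - 3)) →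
        δ * (8 : ℝ) ^ L * 8 ^ L' ≤
          (((univ : Finset ((Fin 3 → (Fin L → Bool)) × (Fin 3 → (Fin L' → Bool)))).filter fun R =>
            (∀ i, wt (R.1 i) % 3 = i.val) ∧ (∀ j, wt (R.2 j) % 3 = j.val) ∧
              (∀ i j, F0 y (R.1 i) (R.2 j) = F0 y (R.1 i) (R.2 0)) ∧
                (∀ i j, F1 y (R.2 j) (R.1 i) = F1 y (R.2 j) (R.1 0))).card : ℝ)) :
    Summit.QuantumAdvantage.QuantumAdvantage.Theses.RingFrame.RingHardLogDeg := by
  classical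
  obtain ⟨δ, hδ, L₀, hL₀⟩ := hG
  refine ringHardLogDeg_of_walkHard ⟨1 - δ / 9, by linarith, 2 * L₀ + 1, fun n hn y hy => ?_⟩
  -- the balanced cut `n = L + L'`
  obtain ⟨L, L', hL, hLL', hL'L, rfl⟩ : ∃ L L' : ℕ, L₀ ≤ L ∧ L ≤ L' ∧ L' ≤ L + 1 ∧ n = L + L' :=
    ⟨n / 2, n - n / 2, by omega, by omega, by omega, by omega⟩
  have hgood := hL₀ L L' hL hLL' hL'L y hy
  have hrect := card_goodRectangles_le_fail (L + L' + 2) y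
  have hrect' : (((univ : Finset ((Fin 3 → (Fin L → Bool)) × (Fin 3 → (Fin L' → Bool)))).filter
      fun R => (∀ i, wt (R.1 i) % 3 = i.val) ∧ (∀ j, wt (R.2 j) % 3 = j.val) ∧
        (∀ i j, F0 y (R.1 i) (R.2 j) = F0 y (R.1 i) (R.2 0)) ∧
          (∀ i j, F1 y (R.2 j) (R.1 i) = F1 y (R.2 j) (R.1 0))).card : ℝ) ≤
      9 * ((4 : ℝ) ^ L * 4 ^ L' *
        ((univ.filter fun w : Fin (L + L') → Bool => ringWinU (L + L' + 2) y w = false).card : ℝ)) := by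
    exact_mod_cast hrect
  -- fail + win = 2^{L+L'}
  have htot : ((univ.filter fun w : Fin (L + L') → Bool => ringWinU (L + L' + 2) y w = false).card : ℝ) +
      ((univ.filter fun w : Fin (L + L') → Bool => ringWinU (L + L' + 2) y w = true).card : ℝ) =
        (2 : ℝ) ^ (L + L') := by
    have h' := Finset.card_filter_add_card_filter_not
      (s := (univ : Finset (Fin (L + L') → Bool))) (fun w => ringWinU (L + L' + 2) y w = false)
    have e : (univ.filter fun w : Fin (L + L') → Bool => ¬ ringWinU (L + L' + 2) y w = false) =
        univ.filter fun w : Fin (L + L') → Bool => ringWinU (L + L' + 2) y w = true := by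
      refine Finset.filter_congr fun w _ => ?_
      cases ringWinU (L + L' + 2) y w <;> simp
    rw [e, card_univ, Fintype.card_fun, Fintype.card_bool, Fintype.card_fin] at h'
    exact_mod_cast h'
  -- `δ·2^{L+L'}/9 ≤ #FAIL`
  set FAIL := ((univ.filter fun w : Fin (L + L') → Bool => ringWinU (L + L' + 2) y w = false).card : ℝ)
    with hFAIL
  have h8L : (8 : ℝ) ^ L = 4 ^ L * 2 ^ L := by rw [← mul_pow]; norm_num
  have h8L' : (8 : ℝ) ^ L' = 4 ^ L' * 2 ^ L' := by rw [← mul_pow]; norm_num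
  have hpos : (0 : ℝ) < (4 : ℝ) ^ L * 4 ^ L' := by positivity
  have hfail : δ / 9 * (2 : ℝ) ^ (L + L') ≤ FAIL := by
    have key : (4 : ℝ) ^ L * 4 ^ L' * (δ / 9 * (2 ^ L * 2 ^ L')) ≤ (4 : ℝ) ^ L * 4 ^ L' * FAIL := by
      have := hgood.trans hrect'
      rw [h8L, h8L'] at this
      nlinarith [this]
    rw [pow_add]
    exact le_of_mul_le_mul_left key hpos
  linarith

end Summit.QuantumAdvantage.QuantumAdvantage.Theorems

end
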